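import Mathlib
import Literature.NumberTheory.DiophantineGeometry.AbcWave0

/-!
# A certified census of abc triples by 5-depth in boxes `c ≤ N` — the enumeration checker

Write `ω₅(abc) := #{p prime : p⁵ ∣ abc}` (the *5-depth count* of an abc triple `a + b = c`,
`0 < a`, `0 < b`, `gcd(a,b) = 1`; in Lean
`((a*b*c).primeFactors.filter (fun p => 5 ≤ (a*b*c).factorization p)).card`).  This file provides an
EXECUTABLE checker `checkCell N R K test : Bool` together with a complete soundness theorem
`checkCell_sound`: if `N < (R+1)⁵` and `checkCell N R K test = true`, then `test a b c = true` for EVERY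
abc triple with `c ≤ N` and `ω₅(abc) ≥ K`.  Instantiated with the hit test `hitTest L`
(`hitTest_sound`), a single evaluation certifies that an explicit list `L` contains every abc HIT
(`rad(abc) < c`) of the cell `{ω₅ ≥ K}` in the box `{c ≤ N}` together with its exact radical; with the
test `fun _ _ _ => false` it certifies that the cell does not meet the box at all (`empty_of_checkCell`).
The evaluations themselves (`native_decide`, declared computational) live with their consumers
(`Summits/ABC/ABC/Theorems/IneffectiveSubspaceDeepRegimeABCCensus*.lean`); this file uses no axiom
beyond `propext`, `Classical.choice`, `Quot.sound`.

## The enumeration (why it is exhaustive)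

If `ω₅(abc) ≥ K`, pick `K` primes `p` with `p⁵ ∣ abc`.  Since `a, b, c` are pairwise coprime, each
`p⁵` divides exactly one member, so `p⁵ ≤ N`, i.e. `p ≤ R` whenever `N < (R+1)⁵`; this gives a
`K`-sublist `T` of `deepPrimes N R` (the primes `p ≤ R` with `p⁵ ≤ N`, ascending) and an assignment of
its members to `a / b / c`.  With `A, B, C` the products of the `p⁵` so assigned: `A ∣ a`, `B ∣ b`,
`C ∣ c`, `A, B, C ≤ N`, and `4ABC ≤ 4abc ≤ c³ ≤ N³` (as `4ab ≤ (a+b)²`).  `patterns N ps K 1 1 1` lists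
every such `(A, B, C)` (walk the ascending prime list: skip / assign to `a` / `b` / `c`, pruned by the two
bounds — `mem_patterns`), and for each pattern `loopBest` walks all solutions of `a + b = c` in the three
residue classes by iterating over the two members with the LARGEST moduli and deriving the third
(`loopAB_sound`, `loopAC_sound`, `loopBC_sound`).  Cost ≈ `Σ_patterns N²/(2·M₁M₂)` inner steps plus three
trial-division factorisations (`Nat.primeFactorsList`) per coprime candidate.

## Main statements

* `checkCell_sound` : exhaustiveness of the enumeration (above);
* `hitTest_sound`   : with `test = hitTest L`, every hit of the cell in the box is listed in `L` (in one
  of the two orientations) with fourth component `= rad a b c`;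
* `empty_of_checkCell` : with `test = fun _ _ _ => false`, no abc triple with `c ≤ N` has `ω₅ ≥ K`.

Part II ties the enumeration to abc triples (`checkCell_sound`, `hitTest_sound`, `depth_lt_of_checkCell`,
`hits_complete`, `pow_lt_pow_of_checkCell`, `lt_rpow_of_checkCell`).

Design notes.  Consumers never unfold `checkCell`: they evaluate it once (`native_decide`) and rewrite
with the `_sound` theorems.  A crux-local checker for the same cells with a Chinese-remainder lattice
walk exists problem-side (`Summits/ABC/ABC/Theorems/DeepRegimeABC/Negative/CensusChecker{,CRT}.lean`,
refuter compute seat, 2026-08-16); the present file is the generic, Literature-side version and differs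
in two points that matter for the DEEP cells: the pattern generator is pruned by the product bound
`4·A·B·C·p^(5k) ≤ N³` (so the cells `ω₅ ≥ 7, …, 11` in boxes up to `10²⁰` have only `10⁴–10⁵`
patterns and are censused in seconds of compiled time), and the per-candidate `test` is a parameter
(hit lists with radicals, emptiness, or any other decidable property of the visited triples).  The radical is computed as
`radL n = (Nat.primeFactorsList n).dedup.prod` (`radL_eq_radical`) member by member and multiplied
(pairwise coprimality), never on the product `abc`.  Cross-checks of the data certified with this
checker against the uncertified censuses of the crux notes (kit jobs j015304 / j015856, 3504 hits below
`10⁷`) and the ABC@home tables are recorded in the consumer files.  Source of the algorithm: this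
project (standard exhaustive search by residue classes); the facts certified are finite computations.
-/

namespace Literature.NumberTheory.DiophantineGeometry.DepthCensus

open UniqueFactorizationMonoid (radical)

/-! ## Executable part -/

/-- `allRange f i₀ n acc = acc && f i₀ && f (i₀+1) && … && f (i₀+n-1)`, tail-recursively. [folklore] -/
def allRange (f : ℕ → Bool) : ℕ → ℕ → Bool → Bool
  | _, 0, acc => acc
  | i₀, n + 1, acc => allRange f (i₀ + 1) n (acc && f i₀)

/-- Walk `a = A·i`, `b = B·j` (`i, j ≥ 1`, `a + b ≤ N`), derive `c = a + b`, keep it when `C ∣ c`.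
[folklore] -/
def loopAB (N A B C : ℕ) (test : ℕ → ℕ → ℕ → Bool) : Bool :=
  allRange (fun i => allRange
    (fun j => !((A * i + B * j) % C == 0) || test (A * i) (B * j) (A * i + B * j))
    1 ((N - A * i) / B) true) 1 (N / A) true

/-- Walk `c = C·k ≤ N`, `a = A·i < c`, derive `b = c - a`, keep it when `B ∣ b`. [folklore] -/
def loopAC (N A B C : ℕ) (test : ℕ → ℕ → ℕ → Bool) : Bool :=
  allRange (fun k => allRange
    (fun i => !((C * k - A * i) % B == 0) || test (A * i) (C * k - A * i) (C * k))
    1 ((C * k - 1) / A) true) 1 (N / C) true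

/-- Walk `c = C·k ≤ N`, `b = B·j < c`, derive `a = c - b`, keep it when `A ∣ a`. [folklore] -/
def loopBC (N A B C : ℕ) (test : ℕ → ℕ → ℕ → Bool) : Bool :=
  allRange (fun k => allRange
    (fun j => !((C * k - B * j) % A == 0) || test (C * k - B * j) (B * j) (C * k))
    1 ((C * k - 1) / B) true) 1 (N / C) true

/-- Dispatch on the smallest modulus: the member carrying it is the derived one. [folklore] -/
def loopBest (N A B C : ℕ) (test : ℕ → ℕ → ℕ → Bool) : Bool :=
  if C ≤ A ∧ C ≤ B then loopAB N A B C test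
  else if B ≤ A then loopAC N A B C test
  else loopBC N A B C test

/-- `patterns N ps k A B C`: all `(A·A', B·B', C·C')` where `A', B', C'` are the products of `p⁵` over the
three parts of a `k`-sublist of `ps` assigned to `a / b / c`, pruned by `A·A' ≤ N` (etc.) and by
`4·(ABC)·p^(5k) ≤ N³` for the least available prime `p` (sound when `ps` is ascending). [folklore] -/
def patterns (N : ℕ) : List ℕ → ℕ → ℕ → ℕ → ℕ → List (ℕ × ℕ × ℕ)
  | _, 0, A, B, C => [(A, B, C)]
  | [], _ + 1, _, _, _ => []
  | p :: ps, k + 1, A, B, C =>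
      if N ^ 3 < 4 * (A * B * C) * p ^ (5 * (k + 1)) then [] else
        patterns N ps (k + 1) A B C ++
        ((if A * p ^ 5 ≤ N then patterns N ps k (A * p ^ 5) B C else []) ++
        ((if B * p ^ 5 ≤ N then patterns N ps k A (B * p ^ 5) C else []) ++
         (if C * p ^ 5 ≤ N then patterns N ps k A B (C * p ^ 5) else [])))

/-- The primes `p ≤ R` with `p⁵ ≤ N`, ascending. [folklore] -/
def deepPrimes (N R : ℕ) : List ℕ :=
  (List.range (R + 1)).filter (fun p => decide (Nat.Prime p) && decide (p ^ 5 ≤ N))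

/-- **The cell checker.** `test` holds on every candidate of every depth pattern of `K` primes from
`deepPrimes N R` in the box `c ≤ N`. [folklore] -/
def checkCell (N R K : ℕ) (test : ℕ → ℕ → ℕ → Bool) : Bool :=
  (patterns N (deepPrimes N R) K 1 1 1).all (fun t => loopBest N t.1 t.2.1 t.2.2 test)

/-- The radical of `n` by trial division: product of the distinct prime factors
(`1` for `n ≤ 1`). [folklore] -/
def radL (n : ℕ) : ℕ :=
  (Nat.primeFactorsList n).dedup.prod

/-- **The hit test** against a list `L` of `(a, b, c, rad abc)`: a candidate passes if `gcd(a,b) ≠ 1`,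
or `c ≤ rad(a)·rad(b)·rad(c)` (no hit), or it is listed — in either orientation — with that radical.
[folklore] -/
def hitTest (L : List (ℕ × ℕ × ℕ × ℕ)) (a b c : ℕ) : Bool :=
  if Nat.gcd a b = 1 then
    (decide (c ≤ radL a * radL b * radL c) ||
      (L.elem (a, b, c, radL a * radL b * radL c) || L.elem (b, a, c, radL a * radL b * radL c)))
  else true

/-! ## Soundness of the loops -/

/-- Specification of `allRange`. [folklore] -/
theorem allRange_eq_true_iff (f : ℕ → Bool) (i₀ n : ℕ) (acc : Bool) :
    allRange f i₀ n acc = true ↔ acc = true ∧ ∀ i, i₀ ≤ i → i < i₀ + n → f i = true := by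
  induction n generalizing i₀ acc with
  | zero =>
    simp only [allRange, Nat.add_zero]
    exact ⟨fun h => ⟨h, fun i h1 h2 => absurd h2 (not_lt.mpr h1)⟩, fun h => h.1⟩
  | succ n ih =>
    rw [allRange, ih]
    simp only [Bool.and_eq_true]
    constructor
    · rintro ⟨⟨hacc, hlo⟩, h⟩
      refine ⟨hacc, fun i hi hi' => ?_⟩
      rcases Nat.eq_or_lt_of_le hi with rfl | hlt
      · exact hlo
      · exact h i hlt (by omega)
    · rintro ⟨hacc, h⟩
      exact ⟨⟨hacc, h i₀ le_rfl (by omega)⟩, fun i hi hi' => h i (by omega) (by omega)⟩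

/-- A body `!(x % M == 0) || t` that evaluates to `true` with `M ∣ x` forces `t = true`. [folklore] -/
theorem of_guard_eq_true {x M : ℕ} {t : Bool} (h : (!(x % M == 0) || t) = true) (hd : M ∣ x) :
    t = true := by
  have hx : x % M = 0 := Nat.mod_eq_zero_of_dvd hd
  simpa [hx] using h

/-- `loopAB` visits every solution. [folklore] -/
theorem loopAB_sound {N A B C : ℕ} {test : ℕ → ℕ → ℕ → Bool} (hA : 0 < A) (hB : 0 < B)
    (h : loopAB N A B C test = true) {a b c : ℕ} (ha : A ∣ a) (hb : B ∣ b) (hc : C ∣ c)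
    (ha0 : 0 < a) (hb0 : 0 < b) (habc : a + b = c) (hcN : c ≤ N) : test a b c = true := by
  obtain ⟨i, rfl⟩ := ha
  obtain ⟨j, rfl⟩ := hb
  rw [loopAB, allRange_eq_true_iff] at h
  have hi : 1 ≤ i := Nat.pos_of_ne_zero (by rintro rfl; simp at ha0)
  have hj : 1 ≤ j := Nat.pos_of_ne_zero (by rintro rfl; simp at hb0)
  have hiN : i < 1 + N / A := by
    have : i ≤ N / A := (Nat.le_div_iff_mul_le hA).mpr (by nlinarith)
    omega
  have h1 := ((allRange_eq_true_iff _ _ _ _).mp (h.2 i hi hiN)).2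
  have hjN : j < 1 + (N - A * i) / B := by
    have : j ≤ (N - A * i) / B := (Nat.le_div_iff_mul_le hB).mpr (by
      have : A * i + B * j ≤ N := habc ▸ hcN
      rw [mul_comm]; omega)
    omega
  have h2 := h1 j hj hjN
  subst habc
  exact of_guard_eq_true h2 hc

/-- `loopAC` visits every solution. [folklore] -/
theorem loopAC_sound {N A B C : ℕ} {test : ℕ → ℕ → ℕ → Bool} (hA : 0 < A) (hC : 0 < C)
    (h : loopAC N A B C test = true) {a b c : ℕ} (ha : A ∣ a) (hb : B ∣ b) (hc : C ∣ c)
    (ha0 : 0 < a) (hb0 : 0 < b) (habc : a + b = c) (hcN : c ≤ N) : test a b c = true := by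
  obtain ⟨i, rfl⟩ := ha
  obtain ⟨k, rfl⟩ := hc
  rw [loopAC, allRange_eq_true_iff] at h
  have hi : 1 ≤ i := Nat.pos_of_ne_zero (by rintro rfl; simp at ha0)
  have hk : 1 ≤ k := Nat.pos_of_ne_zero (by rintro rfl; simp at habc; omega)
  have hkN : k < 1 + N / C := by
    have : k ≤ N / C := (Nat.le_div_iff_mul_le hC).mpr (by nlinarith)
    omega
  have h1 := ((allRange_eq_true_iff _ _ _ _).mp (h.2 k hk hkN)).2
  have hiN : i < 1 + (C * k - 1) / A := by
    have : i ≤ (C * k - 1) / A := (Nat.le_div_iff_mul_le hA).mpr (by rw [mul_comm]; omega)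
    omega
  have h2 := h1 i hi hiN
  have hb' : b = C * k - A * i := by omega
  subst hb'
  exact of_guard_eq_true h2 hb

/-- `loopBC` visits every solution. [folklore] -/
theorem loopBC_sound {N A B C : ℕ} {test : ℕ → ℕ → ℕ → Bool} (hB : 0 < B) (hC : 0 < C)
    (h : loopBC N A B C test = true) {a b c : ℕ} (ha : A ∣ a) (hb : B ∣ b) (hc : C ∣ c)
    (ha0 : 0 < a) (hb0 : 0 < b) (habc : a + b = c) (hcN : c ≤ N) : test a b c = true := by
  obtain ⟨j, rfl⟩ := hb
  obtain ⟨k, rfl⟩ := hc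
  rw [loopBC, allRange_eq_true_iff] at h
  have hj : 1 ≤ j := Nat.pos_of_ne_zero (by rintro rfl; simp at hb0)
  have hk : 1 ≤ k := Nat.pos_of_ne_zero (by rintro rfl; simp at habc; omega)
  have hkN : k < 1 + N / C := by
    have : k ≤ N / C := (Nat.le_div_iff_mul_le hC).mpr (by nlinarith)
    omega
  have h1 := ((allRange_eq_true_iff _ _ _ _).mp (h.2 k hk hkN)).2
  have hjN : j < 1 + (C * k - 1) / B := by
    have : j ≤ (C * k - 1) / B := (Nat.le_div_iff_mul_le hB).mpr (by rw [mul_comm]; omega)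
    omega
  have h2 := h1 j hj hjN
  have ha' : a = C * k - B * j := by omega
  subst ha'
  exact of_guard_eq_true h2 ha

/-- `loopBest` visits every solution. [folklore] -/
theorem loopBest_sound {N A B C : ℕ} {test : ℕ → ℕ → ℕ → Bool} (hA : 0 < A) (hB : 0 < B)
    (hC : 0 < C) (h : loopBest N A B C test = true) {a b c : ℕ} (ha : A ∣ a) (hb : B ∣ b)
    (hc : C ∣ c) (ha0 : 0 < a) (hb0 : 0 < b) (habc : a + b = c) (hcN : c ≤ N) :
    test a b c = true := by
  unfold loopBest at h
  split_ifs at h with h₁ h₂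
  · exact loopAB_sound hA hB h ha hb hc ha0 hb0 habc hcN
  · exact loopAC_sound hA hC h ha hb hc ha0 hb0 habc hcN
  · exact loopBC_sound hB hC h ha hb hc ha0 hb0 habc hcN

/-! ## Soundness of the pattern generator -/

/-- Product of `p⁵` over the members of `T` assigned to part `d` by `τ`. [folklore] -/
def asgProd (τ : ℕ → Fin 3) (d : Fin 3) (T : List ℕ) : ℕ :=
  (T.map (fun p => if τ p = d then p ^ 5 else 1)).prod

/-- `asgProd` of the empty list. [folklore] -/
@[simp] theorem asgProd_nil (τ : ℕ → Fin 3) (d : Fin 3) : asgProd τ d [] = 1 := rfl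

/-- `asgProd` of a cons. [folklore] -/
@[simp] theorem asgProd_cons (τ : ℕ → Fin 3) (d : Fin 3) (p : ℕ) (T : List ℕ) :
    asgProd τ d (p :: T) = (if τ p = d then p ^ 5 else 1) * asgProd τ d T := rfl

/-- The three parts multiply to `∏_{p ∈ T} p⁵`. [folklore] -/
theorem asgProd_mul_mul (τ : ℕ → Fin 3) (T : List ℕ) :
    asgProd τ 0 T * asgProd τ 1 T * asgProd τ 2 T = (T.map (· ^ 5)).prod := by
  induction T with
  | nil => simp
  | cons p T ih =>
    simp only [asgProd_cons, List.map_cons, List.prod_cons]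
    have h3 : ∀ x : Fin 3, x = 0 ∨ x = 1 ∨ x = 2 := by decide
    rcases h3 (τ p) with h | h | h <;> simp [h] <;> rw [← ih] <;> ring

/-- `1 ≤ asgProd` when all members are `≥ 1`. [folklore] -/
theorem one_le_asgProd (τ : ℕ → Fin 3) (d : Fin 3) {T : List ℕ} (hT : ∀ p ∈ T, 1 ≤ p) :
    1 ≤ asgProd τ d T := by
  induction T with
  | nil => simp
  | cons p T ih =>
    rw [asgProd_cons]
    have hp : 1 ≤ p := hT p (by simp)
    have ih' := ih (fun q hq => hT q (by simp [hq]))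
    split_ifs
    · exact one_le_mul (Nat.one_le_pow _ _ hp) ih'
    · simpa using ih'

/-- An ascending lower bound: if every member of `T` is `≥ p` then `p^(5·|T|) ≤ ∏_{T} q⁵`. [folklore] -/
theorem pow_le_prod_map_pow {p : ℕ} {T : List ℕ} (hT : ∀ q ∈ T, p ≤ q) :
    p ^ (5 * T.length) ≤ (T.map (· ^ 5)).prod := by
  induction T with
  | nil => simp
  | cons q T ih =>
    simp only [List.length_cons, List.map_cons, List.prod_cons]
    have hq : p ≤ q := hT q (by simp)
    have ih' := ih (fun r hr => hT r (by simp [hr]))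
    calc p ^ (5 * (T.length + 1)) = p ^ 5 * p ^ (5 * T.length) := by ring
      _ ≤ q ^ 5 * (T.map (· ^ 5)).prod :=
          Nat.mul_le_mul (Nat.pow_le_pow_left hq 5) ih'

/-- **Completeness of `patterns`.** For an ascending list `ps` of positive numbers, every `k`-sublist
`T` and every assignment `τ` whose three part-products (times `A, B, C`) respect the two prunings is
generated. [folklore] -/
theorem mem_patterns (N : ℕ) : ∀ (ps : List ℕ) (k A B C : ℕ) (T : List ℕ) (τ : ℕ → Fin 3),
    T.Sublist ps → T.length = k → ps.Pairwise (· ≤ ·) → (∀ p ∈ ps, 1 ≤ p) →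
    A * asgProd τ 0 T ≤ N → B * asgProd τ 1 T ≤ N → C * asgProd τ 2 T ≤ N →
    4 * ((A * asgProd τ 0 T) * (B * asgProd τ 1 T) * (C * asgProd τ 2 T)) ≤ N ^ 3 →
    (A * asgProd τ 0 T, B * asgProd τ 1 T, C * asgProd τ 2 T) ∈ patterns N ps k A B C := by
  intro ps
  induction ps with
  | nil =>
    intro k A B C T τ hsub hlen _ _ _ _ _ _
    have hT : T = [] := List.sublist_nil.mp hsub
    subst hT
    simp only [List.length_nil] at hlen
    subst hlen
    simp [patterns]
  | cons p ps ih =>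
    intro k A B C T τ hsub hlen hsort hpos hA hB hC hABC
    have hsort' : ps.Pairwise (· ≤ ·) := hsort.of_cons
    have hpos' : ∀ q ∈ ps, 1 ≤ q := fun q hq => hpos q (by simp [hq])
    cases k with
    | zero =>
      have hT : T = [] := List.eq_nil_of_length_eq_zero hlen
      subst hT
      simp [patterns]
    | succ k =>
      -- the pruning test fails
      have hge : ∀ q ∈ T, p ≤ q := by
        intro q hq
        have hq' : q ∈ p :: ps := hsub.subset hq
        rcases List.mem_cons.mp hq' with rfl | hq''
        · exact le_rfl
        · exact List.rel_of_pairwise_cons hsort hq''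
      have hprune : ¬ N ^ 3 < 4 * (A * B * C) * p ^ (5 * (k + 1)) := by
        rw [not_lt, ← hlen]
        calc 4 * (A * B * C) * p ^ (5 * T.length)
            ≤ 4 * (A * B * C) * (T.map (· ^ 5)).prod :=
              Nat.mul_le_mul_left _ (pow_le_prod_map_pow hge)
          _ = 4 * ((A * asgProd τ 0 T) * (B * asgProd τ 1 T) * (C * asgProd τ 2 T)) := by
              rw [← asgProd_mul_mul τ T]; ring
          _ ≤ N ^ 3 := hABC
      rw [patterns, if_neg hprune]
      rcases hsub with _ | ⟨_, hsub'⟩ | ⟨_, hsub'⟩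
      · -- `T` avoids `p`
        exact List.mem_append_left _ (ih (k + 1) A B C T τ hsub' hlen hsort' hpos' hA hB hC hABC)
      · -- `T = p :: T'`
        rename_i T'
        simp only [List.length_cons, Nat.add_right_cancel_iff] at hlen
        have h3 : ∀ x : Fin 3, x = 0 ∨ x = 1 ∨ x = 2 := by decide
        have h1T' : ∀ d, 1 ≤ asgProd τ d T' := fun d =>
          one_le_asgProd τ d (fun q hq => hpos' q (hsub'.subset hq))
        refine List.mem_append_right _ ?_
        rcases h3 (τ p) with h0 | h1 | h2
        · -- assigned to `a`
          have eA : A * asgProd τ 0 (p :: T') = (A * p ^ 5) * asgProd τ 0 T' := by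
            simp [asgProd_cons, h0]; ring
          have eB : B * asgProd τ 1 (p :: T') = B * asgProd τ 1 T' := by
            simp [asgProd_cons, h0]
          have eC : C * asgProd τ 2 (p :: T') = C * asgProd τ 2 T' := by
            simp [asgProd_cons, h0]
          rw [eA] at hA hABC ⊢; rw [eB] at hB hABC ⊢; rw [eC] at hC hABC ⊢
          have hle : A * p ^ 5 ≤ N :=
            le_trans (Nat.le_mul_of_pos_right _ (h1T' 0)) hA
          refine List.mem_append_left _ ?_
          rw [if_pos hle]
          exact ih k (A * p ^ 5) B C T' τ hsub' hlen hsort' hpos' hA hB hC hABC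
        · -- assigned to `b`
          have eA : A * asgProd τ 0 (p :: T') = A * asgProd τ 0 T' := by
            simp [asgProd_cons, h1]
          have eB : B * asgProd τ 1 (p :: T') = (B * p ^ 5) * asgProd τ 1 T' := by
            simp [asgProd_cons, h1]; ring
          have eC : C * asgProd τ 2 (p :: T') = C * asgProd τ 2 T' := by
            simp [asgProd_cons, h1]
          rw [eA] at hA hABC ⊢; rw [eB] at hB hABC ⊢; rw [eC] at hC hABC ⊢
          have hle : B * p ^ 5 ≤ N :=
            le_trans (Nat.le_mul_of_pos_right _ (h1T' 1)) hB
          refine List.mem_append_right _ (List.mem_append_left _ ?_)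
          rw [if_pos hle]
          exact ih k A (B * p ^ 5) C T' τ hsub' hlen hsort' hpos' hA hB hC hABC
        · -- assigned to `c`
          have eA : A * asgProd τ 0 (p :: T') = A * asgProd τ 0 T' := by
            simp [asgProd_cons, h2]
          have eB : B * asgProd τ 1 (p :: T') = B * asgProd τ 1 T' := by
            simp [asgProd_cons, h2]
          have eC : C * asgProd τ 2 (p :: T') = (C * p ^ 5) * asgProd τ 2 T' := by
            simp [asgProd_cons, h2]; ring
          rw [eA] at hA hABC ⊢; rw [eB] at hB hABC ⊢; rw [eC] at hC hABC ⊢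
          have hle : C * p ^ 5 ≤ N :=
            le_trans (Nat.le_mul_of_pos_right _ (h1T' 2)) hC
          refine List.mem_append_right _ (List.mem_append_right _ ?_)
          rw [if_pos hle]
          exact ih k A B (C * p ^ 5) T' τ hsub' hlen hsort' hpos' hA hB hC hABC

/-! # Part II — soundness on depth cells, the hit test, quality ceilings -/

/-! ## The deep primes -/

/-- Membership in `deepPrimes`. [folklore] -/
theorem mem_deepPrimes {N R p : ℕ} : p ∈ deepPrimes N R ↔ p ≤ R ∧ p.Prime ∧ p ^ 5 ≤ N := by
  simp [deepPrimes, List.mem_filter, List.mem_range]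

/-- `deepPrimes` is ascending. [folklore] -/
theorem deepPrimes_sorted (N R : ℕ) : (deepPrimes N R).Pairwise (· ≤ ·) :=
  List.pairwise_le_range.filter _

/-- `deepPrimes` has no duplicates. [folklore] -/
theorem deepPrimes_nodup (N R : ℕ) : (deepPrimes N R).Nodup :=
  List.nodup_range.filter _

/-! ## Arithmetic of abc triples -/

/-- In an abc triple the members are pairwise coprime. [folklore] -/
theorem coprime_of_isABCTriple {a b c : ℕ} (h : IsABCTriple a b c) :
    Nat.Coprime a b ∧ Nat.Coprime a c ∧ Nat.Coprime b c := by
  obtain ⟨-, -, hsum, hcop⟩ := h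
  refine ⟨hcop, ?_, ?_⟩
  · rw [← hsum]; exact Nat.coprime_self_add_right.mpr hcop
  · rw [← hsum]; exact Nat.coprime_add_self_right.mpr hcop.symm

/-- A prime dividing one member of a coprime pair does not divide the other. [folklore] -/
theorem not_dvd_of_coprime {p m n : ℕ} (hp : p.Prime) (h : Nat.Coprime m n) (hm : p ∣ m) : ¬ p ∣ n := by
  intro hn
  have h1 : p ∣ Nat.gcd m n := Nat.dvd_gcd hm hn
  rw [Nat.Coprime.gcd_eq_one h] at h1
  exact hp.one_lt.ne' (Nat.dvd_one.mp h1)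

/-- **In an abc triple a prime power `p⁵ ∣ abc` divides one member.** [folklore] -/
theorem pow_dvd_or {a b c p : ℕ} (habc : IsABCTriple a b c) (hp : p.Prime)
    (h : p ^ 5 ∣ a * b * c) : p ^ 5 ∣ a ∨ p ^ 5 ∣ b ∨ p ^ 5 ∣ c := by
  obtain ⟨hab, hac, hbc⟩ := coprime_of_isABCTriple habc
  by_cases hpc : p ∣ c
  · have hpa : ¬ p ∣ a := fun hpa => not_dvd_of_coprime hp hac hpa hpc
    have hpb : ¬ p ∣ b := fun hpb => not_dvd_of_coprime hp hbc hpb hpc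
    have hcop : Nat.Coprime (p ^ 5) (a * b) :=
      Nat.Coprime.pow_left 5 (Nat.Coprime.mul_right ((Nat.Prime.coprime_iff_not_dvd hp).mpr hpa)
        ((Nat.Prime.coprime_iff_not_dvd hp).mpr hpb))
    exact Or.inr (Or.inr (hcop.dvd_of_dvd_mul_left h))
  · have hcop : Nat.Coprime (p ^ 5) c :=
      Nat.Coprime.pow_left 5 ((Nat.Prime.coprime_iff_not_dvd hp).mpr hpc)
    have hab' : p ^ 5 ∣ a * b := hcop.dvd_of_dvd_mul_right h
    by_cases hpa : p ∣ a
    · have hpb : ¬ p ∣ b := not_dvd_of_coprime hp hab hpa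
      have hcopb : Nat.Coprime (p ^ 5) b :=
        Nat.Coprime.pow_left 5 ((Nat.Prime.coprime_iff_not_dvd hp).mpr hpb)
      exact Or.inl (hcopb.dvd_of_dvd_mul_right hab')
    · have hcopa : Nat.Coprime (p ^ 5) a :=
        Nat.Coprime.pow_left 5 ((Nat.Prime.coprime_iff_not_dvd hp).mpr hpa)
      exact Or.inr (Or.inl (hcopa.dvd_of_dvd_mul_left hab'))

/-- `4abc ≤ N³` for `a + b = c ≤ N`. [folklore] -/
theorem four_mul_le_cube {a b c N : ℕ} (hsum : a + b = c) (hcN : c ≤ N) :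
    4 * (a * b * c) ≤ N ^ 3 := by
  have h4 : 4 * (a * b) ≤ c ^ 2 := by
    subst hsum
    zify
    nlinarith [sq_nonneg ((a : ℤ) - b)]
  calc 4 * (a * b * c) = 4 * (a * b) * c := by ring
    _ ≤ c ^ 2 * c := Nat.mul_le_mul_right _ h4
    _ = c ^ 3 := by ring
    _ ≤ N ^ 3 := Nat.pow_le_pow_left hcN 3

/-- A part product of distinct primes each of whose fifth powers divides `x` divides `x`. [folklore] -/
theorem asgProd_dvd {τ : ℕ → Fin 3} {d : Fin 3} {x : ℕ} :
    ∀ {T : List ℕ}, T.Nodup → (∀ p ∈ T, p.Prime) → (∀ p ∈ T, τ p = d → p ^ 5 ∣ x) →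
      asgProd τ d T ∣ x
  | [], _, _, _ => by simp
  | p :: T, hnd, hpr, h => by
    rw [asgProd_cons]
    have hnd' := List.nodup_cons.mp hnd
    have ih : asgProd τ d T ∣ x :=
      asgProd_dvd hnd'.2 (fun q hq => hpr q (by simp [hq])) (fun q hq hq' => h q (by simp [hq]) hq')
    split_ifs with hτ
    · refine Nat.Coprime.mul_dvd_of_dvd_of_dvd ?_ (h p (by simp) hτ) ih
      apply Nat.Coprime.pow_left
      unfold asgProd
      rw [Nat.coprime_list_prod_right_iff]
      intro m hm
      obtain ⟨q, hq, rfl⟩ := List.mem_map.mp hm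
      split_ifs
      · apply Nat.Coprime.pow_right
        have hpq : p ≠ q := fun e => hnd'.1 (e ▸ hq)
        exact (Nat.coprime_primes (hpr p (by simp)) (hpr q (by simp [hq]))).mpr hpq
      · exact Nat.coprime_one_right p
    · simpa using ih

/-! ## Soundness of the cell checker -/

/-- **Soundness of `checkCell`.** If `N < (R+1)⁵` and the checker accepts, then `test` holds on every
abc triple with `c ≤ N` and `ω₅(abc) ≥ K`. [folklore] -/
theorem checkCell_sound {N R K : ℕ} {test : ℕ → ℕ → ℕ → Bool} (hR : N < (R + 1) ^ 5)
    (h : checkCell N R K test = true) {a b c : ℕ} (habc : IsABCTriple a b c) (hcN : c ≤ N)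
    (hK : K ≤ ((a * b * c).primeFactors.filter (fun p => 5 ≤ (a * b * c).factorization p)).card) :
    test a b c = true := by
  obtain ⟨ha, hb, hsum, hcop⟩ := habc
  have hc : 0 < c := by omega
  have habc0 : a * b * c ≠ 0 := by positivity
  -- choose `K` deep primes
  obtain ⟨S, hSsub, hScard⟩ := Finset.exists_subset_card_eq hK
  have hS : ∀ p ∈ S, p.Prime ∧ p ^ 5 ∣ a * b * c := by
    intro p hp
    have hp' := hSsub hp
    rw [Finset.mem_filter, Nat.mem_primeFactors] at hp'
    exact ⟨hp'.1.1, (hp'.1.1.pow_dvd_iff_le_factorization habc0).mpr hp'.2⟩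
  -- the assignment and the sublist
  set τ : ℕ → Fin 3 := fun p => if p ^ 5 ∣ a then 0 else if p ^ 5 ∣ b then 1 else 2 with hτ
  set T : List ℕ := (deepPrimes N R).filter (· ∈ S) with hT
  have hTsub : T.Sublist (deepPrimes N R) := List.filter_sublist
  have hmemT : ∀ p, p ∈ T ↔ p ∈ S := by
    intro p
    simp only [hT, List.mem_filter, decide_eq_true_eq, mem_deepPrimes]
    constructor
    · exact fun h => h.2
    · intro hp
      obtain ⟨hpr, hdvd⟩ := hS p hp
      have hp5 : p ^ 5 ≤ N := by
        rcases pow_dvd_or ⟨ha, hb, hsum, hcop⟩ hpr hdvd with h | h | h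
        · exact (Nat.le_of_dvd ha h).trans (by omega)
        · exact (Nat.le_of_dvd hb h).trans (by omega)
        · exact (Nat.le_of_dvd hc h).trans hcN
      refine ⟨⟨?_, hpr, hp5⟩, hp⟩
      by_contra hlt
      have : (R + 1) ^ 5 ≤ p ^ 5 := Nat.pow_le_pow_left (by omega) 5
      omega
  have hTnd : T.Nodup := (deepPrimes_nodup N R).filter _
  have hTpr : ∀ p ∈ T, p.Prime := fun p hp => (hS p ((hmemT p).mp hp)).1
  have hTlen : T.length = K := by
    rw [← List.toFinset_card_of_nodup hTnd, ← hScard]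
    congr 1
    ext p
    rw [List.mem_toFinset, hmemT]
  -- what the assignment means
  have hτa : ∀ p, τ p = 0 → p ^ 5 ∣ a := by
    intro p hp
    by_contra hn
    simp only [hτ, hn, if_false] at hp
    split_ifs at hp <;> exact absurd hp (by decide)
  have hτb : ∀ p, τ p = 1 → p ^ 5 ∣ b := by
    intro p hp
    by_contra hn
    simp only [hτ, hn, if_false] at hp
    split_ifs at hp <;> exact absurd hp (by decide)
  have hτc : ∀ p ∈ T, τ p = 2 → p ^ 5 ∣ c := by
    intro p hpT hp
    obtain ⟨hpr, hdvd⟩ := hS p ((hmemT p).mp hpT)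
    rcases pow_dvd_or ⟨ha, hb, hsum, hcop⟩ hpr hdvd with h | h | h
    · simp [hτ, h] at hp
    · have hna : ¬ p ^ 5 ∣ a := by
        intro h'
        simp [hτ, h'] at hp
      simp [hτ, hna, h] at hp
    · exact h
  -- the part products divide the members
  have hA : asgProd τ 0 T ∣ a := asgProd_dvd hTnd hTpr (fun p _ hp => hτa p hp)
  have hB : asgProd τ 1 T ∣ b := asgProd_dvd hTnd hTpr (fun p _ hp => hτb p hp)
  have hC : asgProd τ 2 T ∣ c := asgProd_dvd hTnd hTpr hτc
  have hAle : 1 * asgProd τ 0 T ≤ N := by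
    rw [one_mul]; exact (Nat.le_of_dvd ha hA).trans (by omega)
  have hBle : 1 * asgProd τ 1 T ≤ N := by
    rw [one_mul]; exact (Nat.le_of_dvd hb hB).trans (by omega)
  have hCle : 1 * asgProd τ 2 T ≤ N := by
    rw [one_mul]; exact (Nat.le_of_dvd hc hC).trans hcN
  have hABC : 4 * ((1 * asgProd τ 0 T) * (1 * asgProd τ 1 T) * (1 * asgProd τ 2 T)) ≤ N ^ 3 := by
    simp only [one_mul]
    calc 4 * (asgProd τ 0 T * asgProd τ 1 T * asgProd τ 2 T) ≤ 4 * (a * b * c) :=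
          Nat.mul_le_mul_left 4 (Nat.mul_le_mul (Nat.mul_le_mul (Nat.le_of_dvd ha hA)
            (Nat.le_of_dvd hb hB)) (Nat.le_of_dvd hc hC))
      _ ≤ N ^ 3 := four_mul_le_cube hsum hcN
  -- the pattern is generated ...
  have hmem := mem_patterns N (deepPrimes N R) K 1 1 1 T τ hTsub hTlen (deepPrimes_sorted N R)
    (fun p hp => (mem_deepPrimes.mp hp).2.1.one_le) hAle hBle hCle hABC
  -- ... and its loop accepts
  rw [checkCell, List.all_eq_true] at h
  have hloop := h _ hmem
  simp only at hloop
  have h1 : ∀ d, 0 < 1 * asgProd τ d T := fun d => by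
    rw [one_mul]
    exact one_le_asgProd τ d (fun p hp => (hTpr p hp).one_le)
  have hA' : 1 * asgProd τ 0 T ∣ a := by rwa [one_mul]
  have hB' : 1 * asgProd τ 1 T ∣ b := by rwa [one_mul]
  have hC' : 1 * asgProd τ 2 T ∣ c := by rwa [one_mul]
  exact loopBest_sound (h1 0) (h1 1) (h1 2) hloop hA' hB' hC' ha hb hsum hcN

/-- **Empty cells.** If the checker accepts the always-failing test, no abc triple with `c ≤ N` has
`ω₅(abc) ≥ K`. [folklore] -/
theorem depth_lt_of_checkCell {N R K : ℕ} (hR : N < (R + 1) ^ 5)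
    (h : checkCell N R K (fun _ _ _ => false) = true) {a b c : ℕ} (habc : IsABCTriple a b c)
    (hcN : c ≤ N) :
    ((a * b * c).primeFactors.filter (fun p => 5 ≤ (a * b * c).factorization p)).card < K := by
  by_contra hK
  exact Bool.false_ne_true (checkCell_sound hR h habc hcN (not_lt.mp hK))

/-! ## The hit test -/

/-- `radL` computes the radical. [folklore] -/
theorem radL_eq_radical (n : ℕ) : radL n = radical n := by
  rw [radL, Nat.radical_eq_prod_primeFactors]
  have hset : n.primeFactors = n.primeFactorsList.dedup.toFinset := by
    ext p
    simp [List.mem_dedup]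
  rw [hset, List.prod_toFinset _ (List.nodup_dedup _)]
  simp

/-- `rad(abc) = rad(a)·rad(b)·rad(c)` for an abc triple, computed by `radL`. [folklore] -/
theorem radL_mul_eq_rad {a b c : ℕ} (habc : IsABCTriple a b c) :
    radL a * radL b * radL c = rad a b c := by
  obtain ⟨hab, hac, hbc⟩ := coprime_of_isABCTriple habc
  rw [radL_eq_radical, radL_eq_radical, radL_eq_radical, rad_def]
  have h1 : IsRelPrime (a * b) c :=
    Nat.coprime_iff_isRelPrime.mp (Nat.Coprime.mul_left hac hbc)
  have h2 : IsRelPrime a b := Nat.coprime_iff_isRelPrime.mp hab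
  rw [UniqueFactorizationMonoid.radical_mul h1, UniqueFactorizationMonoid.radical_mul h2]

/-- **Soundness of the hit test**: an abc hit passing `hitTest L` is listed with its radical.
[folklore] -/
theorem hitTest_sound {L : List (ℕ × ℕ × ℕ × ℕ)} {a b c : ℕ} (habc : IsABCTriple a b c)
    (h : hitTest L a b c = true) (hlt : rad a b c < c) :
    (a, b, c, rad a b c) ∈ L ∨ (b, a, c, rad a b c) ∈ L := by
  have hrad := radL_mul_eq_rad habc
  have hcop : Nat.gcd a b = 1 := habc.2.2.2
  unfold hitTest at h
  rw [if_pos hcop, hrad] at h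
  simp only [Bool.or_eq_true, decide_eq_true_eq] at h
  rcases h with h | h | h
  · exact absurd hlt (not_lt.mpr h)
  · exact Or.inl (List.mem_of_elem_eq_true h)
  · exact Or.inr (List.mem_of_elem_eq_true h)

/-- **Census.** If the checker accepts `hitTest L`, every abc hit of the cell `{ω₅ ≥ K}` in the box
`{c ≤ N}` is listed in `L` with its radical, in one of the two orientations. [folklore] -/
theorem hits_complete {N R K : ℕ} {L : List (ℕ × ℕ × ℕ × ℕ)} (hR : N < (R + 1) ^ 5)
    (h : checkCell N R K (hitTest L) = true) {a b c : ℕ} (habc : IsABCTriple a b c) (hcN : c ≤ N)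
    (hK : K ≤ ((a * b * c).primeFactors.filter (fun p => 5 ≤ (a * b * c).factorization p)).card)
    (hlt : rad a b c < c) : (a, b, c, rad a b c) ∈ L ∨ (b, a, c, rad a b c) ∈ L :=
  hitTest_sound habc (checkCell_sound hR h habc hcN hK) hlt

/-- **Quality ceiling on a cell-in-a-box** from the census: if every listed hit has `c^Q < r^P`
(`Q < P`), then `c^Q < rad(abc)^P` for every abc triple of the cell in the box. [folklore] -/
theorem pow_lt_pow_of_checkCell {N R K P Q : ℕ} {L : List (ℕ × ℕ × ℕ × ℕ)} (hR : N < (R + 1) ^ 5)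
    (h : checkCell N R K (hitTest L) = true) (hQP : Q < P)
    (hL : ∀ t ∈ L, t.2.2.1 ^ Q < t.2.2.2 ^ P) {a b c : ℕ} (habc : IsABCTriple a b c) (hcN : c ≤ N)
    (hK : K ≤ ((a * b * c).primeFactors.filter (fun p => 5 ≤ (a * b * c).factorization p)).card) :
    c ^ Q < rad a b c ^ P := by
  by_cases hlt : rad a b c < c
  · rcases hits_complete hR h habc hcN hK hlt with hm | hm
    · exact hL _ hm
    · exact hL _ hm
  · have hc2 : 2 ≤ c := by obtain ⟨ha, hb, hsum, -⟩ := habc; omega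
    have hrad2 : 2 ≤ rad a b c := by
      rw [rad_def, Nat.two_le_radical_iff]
      obtain ⟨ha, hb, -, -⟩ := habc
      calc 2 ≤ c := hc2
        _ = 1 * 1 * c := by ring
        _ ≤ a * b * c := Nat.mul_le_mul_right c (Nat.mul_le_mul ha hb)
    calc c ^ Q ≤ rad a b c ^ Q := Nat.pow_le_pow_left (not_lt.mp hlt) Q
      _ < rad a b c ^ P := Nat.pow_lt_pow_right (by omega) hQP

/-- The same ceiling with a real exponent: `c < rad(abc)^(P/Q)`. [folklore] -/
theorem lt_rpow_of_checkCell {N R K P Q : ℕ} {L : List (ℕ × ℕ × ℕ × ℕ)} (hR : N < (R + 1) ^ 5)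
    (h : checkCell N R K (hitTest L) = true) (hQ : 0 < Q) (hQP : Q < P)
    (hL : ∀ t ∈ L, t.2.2.1 ^ Q < t.2.2.2 ^ P) {a b c : ℕ} (habc : IsABCTriple a b c) (hcN : c ≤ N)
    (hK : K ≤ ((a * b * c).primeFactors.filter (fun p => 5 ≤ (a * b * c).factorization p)).card) :
    (c : ℝ) < ((rad a b c : ℕ) : ℝ) ^ ((P : ℝ) / Q) := by
  have hnat := pow_lt_pow_of_checkCell hR h hQP hL habc hcN hK
  have hQR : (0 : ℝ) < Q := by exact_mod_cast hQ
  have hc0 : (0 : ℝ) ≤ c := Nat.cast_nonneg _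
  have hr0 : (0 : ℝ) ≤ ((rad a b c : ℕ) : ℝ) := Nat.cast_nonneg _
  have hreal : (c : ℝ) ^ (Q : ℝ) < (((rad a b c : ℕ) : ℝ) ^ ((P : ℝ) / Q)) ^ (Q : ℝ) := by
    rw [← Real.rpow_mul hr0, div_mul_cancel₀ _ hQR.ne', Real.rpow_natCast, Real.rpow_natCast]
    exact_mod_cast hnat
  exact lt_of_pow_lt_pow_left₀ Q (Real.rpow_nonneg hr0 _)
    (by simpa [Real.rpow_natCast] using hreal)

end Literature.NumberTheory.DiophantineGeometry.DepthCensus
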